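import Mathlib
import Summits.Ventures.HodgeRepro2.T6InterfaceConj

/-!
# T6N1WitAlg — the doubled surface shadow `⋀(V × V)`: `f^*` along `inl` and the swapping conjugation
(the non-degenerate N1 instance, STATUS l. 11284 (S1)–(S2); owner t6-p1, gen 3)

The surface side of the non-degenerate N1 witness lives on `HS2 K := ⋀_ℂ (V × V)`, `V := H1C K = H¹(B, ℂ)`:
* `pull2 : HBC K →ₐ[ℂ] HS2 K` is `⋀(inl)`, the «pull-back» `f^*` of the shadow (injective, its image the
  sub-exterior-algebra of the first copy);
* `conj2 : HS2 K →+* HS2 K` is the ℂ-antilinear ring involution extending the antilinear swap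
  `C (x, y) := (\bar y, \bar x)` of `V × V` (coefficient conjugation `Conj.conjH1` on each copy), built as
  in the lead's `T6InterfaceConj` (an `ExteriorAlgebra.lift` into `HS2 K` carrying the conjugate
  `ℂ`-algebra structure `HS2conj K`).
The point of the shape (l. 11284 (S3)): `conj2` maps the image of `pull2` into the SECOND copy, so that the
products `ω · conj2 ω'` of the Petersson display leave `pull2 (HBC K)` except on the one block where the
projection formula `z_proj` speaks. No `sorry`; standard axioms. §8(d): uses an L-value-free non-vanishing
device: NO.
-/

namespace Summit.Ventures.HodgeRepro2.T6.N1Wit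

open ExteriorAlgebra Conj

variable {K : Type*} [Field K] [NumberField K]

/-- The doubled first cohomology `V × V`, `V = H¹(B, ℂ)`. -/
abbrev V2 (K : Type*) [Field K] [NumberField K] : Type _ := H1C K × H1C K

/-- The surface shadow `H^*(S, ℂ) := ⋀(V × V)`. -/
abbrev HS2 (K : Type*) [Field K] [NumberField K] : Type _ := ExteriorAlgebra ℂ (V2 K)

/-! ## 1. `f^* := ⋀(inl)` -/

/-- `f^* : H^*(B, ℂ) → H^*(S, ℂ)`, the exterior algebra map of `inl : V → V × V`. -/
noncomputable def pull2 : HBC K →ₐ[ℂ] HS2 K :=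
  ExteriorAlgebra.map (LinearMap.inl ℂ (H1C K) (H1C K))

/-- `f^*` on generators: `ι v ↦ ι (v, 0)`. -/
@[simp] lemma pull2_ι (v : H1C K) : pull2 (ι ℂ v) = ι ℂ ((v, 0) : V2 K) := by
  rw [pull2, ExteriorAlgebra.map_apply_ι]
  rfl

/-- `f^*` on `ιMulti`. -/
lemma pull2_ιMulti {n : ℕ} (v : Fin n → H1C K) :
    pull2 (ιMulti ℂ n v) = ιMulti ℂ n fun i => ((v i, 0) : V2 K) := by
  rw [pull2, ExteriorAlgebra.map_apply_ιMulti]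
  rfl

/-! ## 2. The antilinear swap of `V × V` -/

/-- `C (x, y) := (\bar y, \bar x)` — the antilinear swap. -/
noncomputable def swapConj (p : V2 K) : V2 K := (conjH1 p.2, conjH1 p.1)

/-- `swapConj` unfolded. -/
@[simp] lemma swapConj_apply (p : V2 K) : swapConj p = (conjH1 p.2, conjH1 p.1) := rfl

/-- `swapConj` is additive. -/
lemma swapConj_add (p q : V2 K) : swapConj (p + q) = swapConj p + swapConj q := by
  simp only [swapConj, Prod.fst_add, Prod.snd_add, conjH1_add, Prod.mk_add_mk]

/-- `swapConj` is `ℂ`-antilinear. -/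
lemma swapConj_smul (z : ℂ) (p : V2 K) : swapConj (z • p) = (starRingEnd ℂ z) • swapConj p := by
  simp only [swapConj, Prod.smul_fst, Prod.smul_snd, conjH1_smul, Prod.smul_mk]

/-- `swapConj` is an involution. -/
lemma swapConj_swapConj (p : V2 K) : swapConj (swapConj p) = p := by
  simp only [swapConj, conjH1_conjH1]

/-- `conjH1 0 = 0`. -/
lemma conjH1_zero : conjH1 (0 : H1C K) = 0 := by
  ext i; simp [conjH1]

/-- The swap on the first copy: `(v, 0) ↦ (0, \bar v)`. -/
lemma swapConj_inl (v : H1C K) : swapConj ((v, 0) : V2 K) = (0, conjH1 v) := by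
  simp only [swapConj, conjH1_zero]

/-- The swap on the second copy: `(0, v) ↦ (\bar v, 0)`. -/
lemma swapConj_inr (v : H1C K) : swapConj ((0, v) : V2 K) = (conjH1 v, 0) := by
  simp only [swapConj, conjH1_zero]

/-! ## 3. `HS2 K` with the conjugate `ℂ`-algebra structure, and the conjugation -/

/-- `HS2 K` with the conjugate `ℂ`-algebra structure (`z` acts as `\bar z`). -/
def HS2conj (K : Type*) [Field K] [NumberField K] : Type _ := HS2 K

/-- The ring structure of `HS2conj K` is that of `HS2 K`. -/
noncomputable instance instRingHS2conj : Ring (HS2conj K) := inferInstanceAs (Ring (HS2 K))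

/-- The structure map of the conjugate structure: `z ↦ \bar z · 1`. -/
noncomputable def algebraMapConj2 : ℂ →+* HS2conj K :=
  ((algebraMap ℂ (HS2 K)).comp (starRingEnd ℂ) : ℂ →+* HS2 K)

/-- The conjugate `ℂ`-algebra structure on `HS2conj K`. -/
noncomputable instance instAlgebraHS2conj : Algebra ℂ (HS2conj K) :=
  RingHom.toAlgebra' algebraMapConj2 (fun c x => Algebra.commutes (A := HS2 K) (starRingEnd ℂ c) x)

/-- The structure map of the conjugate structure, in `HS2 K`. -/
lemma HS2conj_algebraMap (z : ℂ) :
    (algebraMap ℂ (HS2conj K) z : HS2 K) = algebraMap ℂ (HS2 K) (starRingEnd ℂ z) := rfl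

/-- The scalar action of the conjugate structure, in `HS2 K`. -/
lemma HS2conj_smul_def (z : ℂ) (x : HS2 K) :
    (z • (show HS2conj K from x) : HS2conj K) = (starRingEnd ℂ z) • x := by
  show (algebraMap ℂ (HS2 K) (starRingEnd ℂ z) : HS2 K) * x = _
  rw [Algebra.smul_def]

/-- The antilinear generator map `p ↦ ι (C p)`, `ℂ`-linear into the conjugate structure. -/
noncomputable def genConj2 : V2 K →ₗ[ℂ] HS2conj K where
  toFun p := (ι ℂ (swapConj p) : HS2 K)
  map_add' p q := by
    show (ι ℂ (swapConj (p + q)) : HS2 K) = ι ℂ (swapConj p) + ι ℂ (swapConj q)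
    rw [swapConj_add, map_add]
  map_smul' z p := by
    simp only [RingHom.id_apply]
    show (ι ℂ (swapConj (z • p)) : HS2 K) = z • (show HS2conj K from ι ℂ (swapConj p))
    rw [HS2conj_smul_def, swapConj_smul, map_smul]

/-- `genConj2` on a vector. -/
lemma genConj2_apply (p : V2 K) : (genConj2 p : HS2 K) = ι ℂ (swapConj p) := rfl

/-- The generator map squares to zero (it lands in the image of `ι`). -/
lemma genConj2_sq_zero (p : V2 K) : genConj2 p * genConj2 p = 0 := by
  show (ι ℂ (swapConj p) : HS2 K) * ι ℂ (swapConj p) = 0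
  exact ι_sq_zero _

/-- The conjugation as a `ℂ`-algebra map into the conjugate structure. -/
noncomputable def conjAlg2 : HS2 K →ₐ[ℂ] HS2conj K :=
  ExteriorAlgebra.lift ℂ ⟨genConj2, genConj2_sq_zero⟩

/-- COMPLEX CONJUGATION ON THE DOUBLED SHADOW: the ring endomorphism of `⋀(V × V)` extending the
antilinear swap `C`. -/
noncomputable def conj2 : HS2 K →+* HS2 K := ((conjAlg2 (K := K)).toRingHom : HS2 K →+* HS2conj K)

/-- `conj2` is `conjAlg2` read in `HS2 K`. -/
lemma conj2_apply (x : HS2 K) : conj2 x = (conjAlg2 x : HS2 K) := rfl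

/-- `conj2` on generators: the swap. -/
@[simp] lemma conj2_ι (p : V2 K) : conj2 (ι ℂ p) = ι ℂ (swapConj p) := by
  rw [conj2_apply]
  show (ExteriorAlgebra.lift ℂ ⟨genConj2, genConj2_sq_zero⟩ (ι ℂ p) : HS2 K) = _
  rw [ExteriorAlgebra.lift_ι_apply]
  rfl

/-- `conj2` on scalars: complex conjugation. -/
@[simp] lemma conj2_algebraMap (z : ℂ) :
    conj2 (algebraMap ℂ (HS2 K) z) = algebraMap ℂ (HS2 K) (starRingEnd ℂ z) := by
  rw [conj2_apply]
  have h := (conjAlg2 (K := K)).commutes z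
  show (conjAlg2 (algebraMap ℂ (HS2 K) z) : HS2 K) = _
  rw [h]
  rfl

/-- `conj2` is `ℂ`-antilinear. -/
lemma conj2_smul (z : ℂ) (x : HS2 K) : conj2 (z • x) = (starRingEnd ℂ z) • conj2 x := by
  rw [conj2_apply, conj2_apply]
  have h := map_smul (conjAlg2 (K := K)) z x
  show (conjAlg2 (z • x) : HS2 K) = _
  rw [h]
  exact HS2conj_smul_def z (conjAlg2 x)

/-- `conj2` is an involution. -/
lemma conj2_conj2 (x : HS2 K) : conj2 (conj2 x) = x := by
  induction x using ExteriorAlgebra.induction with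
  | algebraMap r => rw [conj2_algebraMap, conj2_algebraMap, Complex.conj_conj]
  | ι p => rw [conj2_ι, conj2_ι, swapConj_swapConj]
  | mul a b ha hb => rw [map_mul, map_mul, ha, hb]
  | add a b ha hb => rw [map_add, map_add, ha, hb]

/-- THE SHAPE: conjugation sends the pulled-back generators into the second copy. -/
lemma conj2_pull2_ι (v : H1C K) : conj2 (pull2 (ι ℂ v)) = ι ℂ ((0, conjH1 v) : V2 K) := by
  rw [pull2_ι, conj2_ι, swapConj_inl]

/-- `conj2` on `ιMulti`. -/
lemma conj2_ιMulti {n : ℕ} (p : Fin n → V2 K) :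
    conj2 (ιMulti ℂ n p) = ιMulti ℂ n fun i => swapConj (p i) := by
  induction n with
  | zero => simp [ιMulti_zero_apply]
  | succ n ih =>
    rw [ιMulti_succ_apply, ιMulti_succ_apply, map_mul, conj2_ι, ih]
    rfl

end Summit.Ventures.HodgeRepro2.T6.N1Wit
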